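import Mathlib

/-! Sketch.lean — first lemmas of the three crux-idea cards for HRP2Rigidity (item stmt-CriticalPhenomena-1979).
    Statements only (defs of Prop); they must elaborate. -/

namespace Summit.CriticalPhenomena.Ising3DConformalLimit.Cruxes.HRP2Rigidity.Sketch

open scoped BigOperators
open Complex

abbrev E2 := EuclideanSpace ℝ (Fin 2)
abbrev E3 := EuclideanSpace ℝ (Fin 3)

/-- Reflection positivity of a kernel `k` on `E2`/`E3` with respect to the mirror with unit normal `n`
(invariance under the reflection and positivity of the finite Gram sums over the open half-space). -/
def IsMirrorRP {ι : Type} [Fintype ι] (k : EuclideanSpace ℝ ι → ℝ) (n : EuclideanSpace ℝ ι) : Prop :=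
  (∀ x, k (((ℝ ∙ n)ᗮ).reflection x) = k x) ∧
  ∀ (m : ℕ) (p : Fin m → EuclideanSpace ℝ ι) (c : Fin m → ℝ), (∀ a, 0 < inner ℝ (p a) n) →
    0 ≤ ∑ a, ∑ b, c a * c b * k (p a - ((ℝ ∙ n)ᗮ).reflection (p b))

/-- CARD 1, first lemma (2D emergent spectral condition from two oblique mirrors).
A continuous positive even homogeneous kernel on the punctured plane which is reflection positive with respect to
two mirrors that are neither parallel nor perpendicular has, in EACH of the two frames, forward-light-cone spectral
support; measure-free form: `t ↦ k (t n + s τ)` extends to a holomorphic function of `(t, s)` on the tube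
`{|Im s| < Re t}` (Im t, Re s free). Landau–Widder singularity transfer between the two Laplace representations. -/
def TwoObliqueMirrorsSpectralCondition2D : Prop :=
  ∀ (Δ : ℝ) (k : E2 → ℝ) (n₁ n₂ : E2), 0 < Δ → ‖n₁‖ = 1 → ‖n₂‖ = 1 →
    inner ℝ n₁ n₂ ≠ 0 → |inner ℝ n₁ n₂| ≠ 1 →
    ContinuousOn k {0}ᶜ → (∀ x, x ≠ 0 → 0 < k x) → (∀ x, k (-x) = k x) →
    (∀ c : ℝ, 0 < c → ∀ x, k (c • x) = c ^ (-(2 * Δ)) * k x) →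
    IsMirrorRP k n₁ → IsMirrorRP k n₂ →
    ∀ n τ : E2, (n = n₁ ∨ n = n₂) → ‖τ‖ = 1 → inner ℝ τ n = 0 →
      ∃ F : ℂ × ℂ → ℂ, DifferentiableOn ℂ F {p : ℂ × ℂ | |p.2.im| < p.1.re} ∧
        ∀ t s : ℝ, 0 < t → F ((t : ℂ), (s : ℂ)) = k (t • n + s • τ)

/-- CARD 2, first lemma / thesis (spin from causality: one axis frame suffices).
If a nine-mirror-RP homogeneous kernel (hypotheses of `HRP2Rigidity`) admits, in the frame of the axis `e₀`,
(i) a holomorphic continuation `G (t, w₁, w₂) "=" K (t e₀ + w₁ e₁ + w₂ e₂)` on the forward tube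
`{√((Im w₁)²+(Im w₂)²) < Re t}` and (ii) a continuation to the spacelike Minkowski points `(-iu, q₁, q₂)`,
`u > 0`, `q` real, `q₁²+q₂² > u²`, with REAL values there (spacelike commutativity of the frame-`e₀` commutator),
then `K` is invariant under every linear isometry fixing `e₀`.  (Three axes ⇒ O(3).) -/
def AxialSymmetryFromTubeAndCausality : Prop :=
  ∀ (Δ : ℝ) (K : E3 → ℝ), 1/2 ≤ Δ → Δ ≤ 1 → ContinuousOn K {0}ᶜ → (∀ x, x ≠ 0 → 0 < K x) →
    (∀ c : ℝ, 0 < c → ∀ x, K (c • x) = c ^ (-(2 * Δ)) * K x) →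
    (∀ n : E3, (∃ i j : Fin 3, i ≠ j ∧ (n = EuclideanSpace.single i 1 ∨
        n = EuclideanSpace.single i 1 + EuclideanSpace.single j 1 ∨
        n = EuclideanSpace.single i 1 - EuclideanSpace.single j 1)) → IsMirrorRP K n) →
    (∃ (U : Set (ℂ × ℂ × ℂ)) (G : ℂ × ℂ × ℂ → ℂ), IsOpen U ∧ IsPreconnected U ∧ DifferentiableOn ℂ G U ∧
      {p : ℂ × ℂ × ℂ | Real.sqrt (p.2.1.im ^ 2 + p.2.2.im ^ 2) < p.1.re} ⊆ U ∧
      {p : ℂ × ℂ × ℂ | ∃ u q₁ q₂ : ℝ, 0 < u ∧ u ^ 2 < q₁ ^ 2 + q₂ ^ 2 ∧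
          p = (-(u : ℂ) * I, (q₁ : ℂ), (q₂ : ℂ))} ⊆ U ∧
      (∀ t x₁ x₂ : ℝ, 0 < t → G ((t : ℂ), (x₁ : ℂ), (x₂ : ℂ)) =
          K (t • EuclideanSpace.single 0 1 + x₁ • EuclideanSpace.single 1 1 + x₂ • EuclideanSpace.single 2 1)) ∧
      (∀ u q₁ q₂ : ℝ, 0 < u → u ^ 2 < q₁ ^ 2 + q₂ ^ 2 → (G (-(u : ℂ) * I, (q₁ : ℂ), (q₂ : ℂ))).im = 0)) →
    ∀ (R : E3 ≃ₗᵢ[ℝ] E3), R (EuclideanSpace.single 0 1) = EuclideanSpace.single 0 1 → ∀ x, K (R x) = K x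

/-- CARD 3, first lemma (K-independent continuation domain, coordinate triple).
The three COORDINATE reflection positivities alone already continue `K` holomorphically to the tri-sector
`X = {z : (∀ j, 0 < Re z_j) ∧ ∑ |arg z_j| < π/2}` (Bernstein–Siciak cross theorem with relative extremal function
`2|arg t|/π` of the half-line in the half-plane); same for each orthonormal triple of mirror normals. -/
def CoordinateCrossContinuation : Prop :=
  ∀ (Δ : ℝ) (K : E3 → ℝ), 0 < Δ → ContinuousOn K {0}ᶜ → (∀ x, x ≠ 0 → 0 < K x) →
    (∀ c : ℝ, 0 < c → ∀ x, K (c • x) = c ^ (-(2 * Δ)) * K x) →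
    (∀ i : Fin 3, IsMirrorRP K (EuclideanSpace.single i 1)) →
    ∃ G : (Fin 3 → ℂ) → ℂ,
      DifferentiableOn ℂ G {z : Fin 3 → ℂ | (∀ j, 0 < (z j).re) ∧ ∑ j, |Complex.arg (z j)| < Real.pi / 2} ∧
      ∀ x : Fin 3 → ℝ, (∀ j, 0 < x j) →
        G (fun j => (x j : ℂ)) = K (∑ j, x j • EuclideanSpace.single j 1)

end Summit.CriticalPhenomena.Ising3DConformalLimit.Cruxes.HRP2Rigidity.Sketch
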